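import Summits.BirchSwinnertonDyer.BirchSwinnertonDyer.Theorems.GenusKolyvaginAtTwoGenusDeepSupplyAtTwoNegDiscNarrowHalvingBitIffSteerAt
import Summits.BirchSwinnertonDyer.BirchSwinnertonDyer.Theorems.GenusKolyvaginAtTwoK4NegPhantomTwinTraceDictionary
import HarnessLib

/-!
# Route `GenusKolyvaginAtTwo`, K₄⁻ `K4Neg` (stmt-BirchSwinnertonDyer-31526) / crux 23491, LINE 38 — THE HALVING BIT IN ARITHMETIC CURRENCY:
# `hHalf ⟺ (every Selmer phantom of E has 4 ∤ a_{ℓ₀}(E))`; bit TRUE ⟹ `hHalf`; on the phantom cell `hHalf ⟺ 4 ∤ a_{ℓ₀}(E)`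

LEAD seat `bsd-line-gk2-p1` g30 (cell `bsd-f1-sign2`), third file of the gen (after `…HalvingBitOfTwinHalves` p793302 and `…HalvingBitIffSteerAt`
p793531), `--supports stmt-BirchSwinnertonDyer-31526 --as helper`.  THEOREMS ONLY (no definition, no named fact, no `sorry`); standard axioms.
**BSD is NOT proved by this file; `K4Neg` / crux 23491 / U₂ / Q2 / WALL are NOT proved; nothing is closed by it.**

WHAT.  `halvingBit_iff_steerAt` (p793531: the LEAD g28's K-side one-bit residual `hHalf` of the K₄⁻ cell ⟺ LINE 38's ℚ-side steering clause)
composed with gk2-p4 g35's `𝒩/𝒫` dictionary (`TwinLevelFour.forall_selmer_twist_eq_zero_iff_steerAt`,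
`…forall_selmer_twist_eq_zero_iff_selmer_dying_imp_not_four_dvd`, `…exists_selmer_dying_twist_iff_four_dvd_frobeniusTrace`) gives the residual bit
in the ARITHMETIC currency of the planner's restated K₄⁻ (director (677) / LEAD-BRIEF-g29 §2 (iii) / LEAD-BRIEF-g30 §2):

* ★★★ `halvingBit_iff_forall_selmer_dying_not_four_dvd` — on a prime Heegner frame of a K₄⁻-type curve (`Δ<0`, `r_an(E)=0`, `ρ_{E,2^n}` onto;
  `K = ℚ(√−ℓ₀)`, `d_K` odd, Heegner, `2` split; a model `Wd` of `E^{(d_K)}` with `r_an(Wd) = 1`, `#Sel₂(Wd) = 2`; PRINT: GZK):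
  **`hHalf ⟺ ∀ y ∈ Sel₂(E) ∖ 0` dying on `Γ_{ℚ(E[4])}`, `¬ 4 ∣ a_{ℓ₀}(E)`.**
* `halvingBit_of_selmer_disentangled` — **bit TRUE ⟹ hHalf**: if every non-zero class of `Sel₂(E)` survives on `Γ_{ℚ(E[4])}` then the halving bit
  holds at EVERY prime Heegner frame (only `⟸` of the dictionary, so no `r_an(Wd) = 1`); the ℚ-side counterpart of g29's `halvingBit_of_nonPhantom`.
* `halvingBit_iff_not_four_dvd_of_selmer_phantom` — **on the phantom cell** (a non-zero `x ∈ Sel₂(E)` dying on `Γ_{ℚ(E[4])}` given):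
  **`hHalf ⟺ ¬ 4 ∣ a_{ℓ₀}(E)`**, i.e. `hHalf` is the (α)/(β) bit of gk2-p3/gk2-p4 g34 exactly — it HOLDS at the (α)-frames (`a_{ℓ₀} ≡ 2 (mod 4)`) and
  FAILS at the (β)-frames (`4 ∣ a_{ℓ₀}`) — the kernel form of LEAD-BRIEF-g29 §3's opening sentence.

References: [LawsonWuthrich2016] §3, §7.1; [MazurRubin2010] Def. 3.1, Lemma 2.10–2.11, Prop. 3.3; [GrossLMS1991] §9 Prop. 9.6;
[SilvermanAEC2009] Thm. V.2.3.1, X.5 Cor. 5.4, VIII.§2.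
-/

set_option linter.dupNamespace false -- tree convention: `Summit.BirchSwinnertonDyer.BirchSwinnertonDyer.Theorems` (summit = sub-problem)
set_option autoImplicit false

noncomputable section

open scoped Classical Pointwise

namespace Summit.BirchSwinnertonDyer.BirchSwinnertonDyer.Theorems.GenusExact.PlusDescent.TwinHalves

open WeierstrassCurve Field NumberField IsDedekindDomain
open Literature.NumberTheory.GaloisRepresentations Literature.NumberTheory.EllipticCurves
open Summit.BirchSwinnertonDyer.BirchSwinnertonDyer.Theses.GenusKolyvaginAtTwo (MultPublishedInputsAtTwo)
open Summit.BirchSwinnertonDyer.BirchSwinnertonDyer.Theorems.GenusExact.PhantomDescentBit.TwinLevelFour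
  (forall_selmer_twist_eq_zero_iff_steerAt forall_selmer_twist_eq_zero_iff_selmer_dying_imp_not_four_dvd
    exists_selmer_dying_twist_iff_four_dvd_frobeniusTrace)

/-! ## §5 The halving bit in the currency `4 ∣ a_{ℓ₀}(E)` -/

/-- ★★★ **`hHalf ⟺ (every Selmer phantom of E has 4 ∤ a_{ℓ₀}(E))`.**  Frame: `E = W/ℚ` globally minimal, `Δ < 0`, `r_an(E) = 0`, `ρ_{E,2^n}` onto for
all `n ≥ 1`; `K` imaginary quadratic with odd `d_K = −ℓ₀`, Heegner for `N_E`, `2` split; `Wd` an elliptic model of `E^{(d_K)}` with `r_an(Wd) = 1` and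
`#Sel₂(Wd) = 2`; PRINT: GZK (`MultPublishedInputsAtTwo`).  THEN every `R ∈ E(K)` with a `Γ_{K(E[4])}`-fixed half lies in `2E(K)` IFF every non-zero class
of `Sel₂(W)` dying on `Γ_{ℚ(W[4])}` has `¬ 4 ∣ a_{ℓ₀}(W)`.  Proof: p793531 (`hHalf ⟺ SteerAt`) ∘ gk2-p4 g35 (`SteerAt ⟺ 𝒩(Wd) ⟺ …`).  CONDITIONAL only on
the PRINT item GZK; BSD is NOT proved; nothing is closed. [cite: LawsonWuthrich2016, §3, §7.1] [cite: MazurRubin2010, Def. 3.1, Prop. 3.3]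
[cite: GrossLMS1991, §9 Prop. 9.6] -/
theorem halvingBit_iff_forall_selmer_dying_not_four_dvd
    (W : WeierstrassCurve ℚ) [W.IsElliptic] [W.IsGloballyMinimal]
    (hr0 : W.analyticRank = 0) (hρ : ∀ n : ℕ, 0 < n → W.HasSurjectiveModNGaloisRep ((2 : ℤ) ^ n)) (hneg : W.Δ < 0)
    (K : Type) [Field K] [NumberField K] (hIQ : IsImaginaryQuadratic K) (hodd : Odd (discr K))
    (hHe : SatisfiesHeegnerHypothesis (W.conductorNorm ℤ) K)
    (ℓ₀ : ℕ) [Fact ℓ₀.Prime] (hdK : discr K = -(ℓ₀ : ℤ)) (h2K : ((Ideal.span {(2 : ℤ)}).primesOver (𝓞 K)).ncard = 2)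
    (Wd : WeierstrassCurve ℚ) [Wd.IsElliptic] (hWd : ∃ C : VariableChange ℚ, C • W.quadraticTwist (discr K : ℚ) = Wd)
    (hrd : Wd.analyticRank = 1) (hSel : Nat.card (Wd.selmerGroup 2) = 2) (hGZK : MultPublishedInputsAtTwo) :
    (∀ (R : (W.baseChange K).toAffine.Point) (Q : geomPoints (W.baseChange K)),
      (∀ ρ ∈ torsionFixing (W.baseChange K) (4 : ℤ), ρ • Q = Q) → (2 : ℤ) • Q = toGeomPoints (W.baseChange K) R →
      ∃ R' : (W.baseChange K).toAffine.Point, (2 : ℤ) • R' = R) ↔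
    (∀ y ∈ W.selmerGroup 2, y ≠ 0 → (∀ h ∈ torsionFixing W (4 : ℤ), h1Eval W (2 : ℤ) y h = 0) → ¬ (4 : ℤ) ∣ W.frobeniusTrace ℓ₀) := by
  have hs2 : W.HasSurjectiveModNGaloisRep 2 := by simpa using hρ 1 one_pos
  have hs4 : W.HasSurjectiveModNGaloisRep 4 := by have h := hρ 2 two_pos; norm_num at h; exact h
  obtain ⟨C, hC⟩ := hWd
  rw [halvingBit_iff_steerAt W hr0 hρ hneg K hIQ hodd hHe ℓ₀ hdK h2K Wd ⟨C, hC⟩ hrd hSel hGZK,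
    ← forall_selmer_twist_eq_zero_iff_steerAt W hs2 hneg hIQ hodd hHe h2K hdK hC,
    forall_selmer_twist_eq_zero_iff_selmer_dying_imp_not_four_dvd W hs2 hs4 hneg hIQ hodd hHe h2K hdK hC]

/-- **Bit TRUE ⟹ hHalf (ℚ-side form).**  Frame as above but WITHOUT the rank hypothesis on the twin (`Wd` any elliptic model of `E^{(d_K)}` with
`#Sel₂(Wd) = 2`): if every non-zero class of `Sel₂(W)` SURVIVES on `Γ_{ℚ(W[4])}` (the 2-adic bit TRUE: the Lawson–Wuthrich class is not Selmer), then
the steering clause holds vacuously and `halvingBit_of_steerAt` (p793302) gives the halving bit over `K` at EVERY prime Heegner frame.  The ℚ-side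
counterpart of g29's all-places `halvingBit_of_nonPhantom`.  CONDITIONAL only on GZK; BSD is NOT proved.
[cite: LawsonWuthrich2016, §7.1] [cite: MazurRubin2010, Prop. 3.3] -/
theorem halvingBit_of_selmer_disentangled
    (W : WeierstrassCurve ℚ) [W.IsElliptic] [W.IsGloballyMinimal]
    (hr0 : W.analyticRank = 0) (hρ : ∀ n : ℕ, 0 < n → W.HasSurjectiveModNGaloisRep ((2 : ℤ) ^ n)) (hneg : W.Δ < 0)
    (K : Type) [Field K] [NumberField K] (hIQ : IsImaginaryQuadratic K) (hodd : Odd (discr K))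
    (hHe : SatisfiesHeegnerHypothesis (W.conductorNorm ℤ) K)
    (ℓ₀ : ℕ) [Fact ℓ₀.Prime] (hdK : discr K = -(ℓ₀ : ℤ)) (h2K : ((Ideal.span {(2 : ℤ)}).primesOver (𝓞 K)).ncard = 2)
    (Wd : WeierstrassCurve ℚ) [Wd.IsElliptic] (hWd : ∃ C : VariableChange ℚ, C • W.quadraticTwist (discr K : ℚ) = Wd)
    (hSel : Nat.card (Wd.selmerGroup 2) = 2) (hGZK : MultPublishedInputsAtTwo)
    (hdis : ∀ y ∈ W.selmerGroup 2, y ≠ 0 → ∃ h ∈ torsionFixing W (4 : ℤ), h1Eval W (2 : ℤ) y h ≠ 0) :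
    ∀ (R : (W.baseChange K).toAffine.Point) (Q : geomPoints (W.baseChange K)),
      (∀ ρ ∈ torsionFixing (W.baseChange K) (4 : ℤ), ρ • Q = Q) → (2 : ℤ) • Q = toGeomPoints (W.baseChange K) R →
      ∃ R' : (W.baseChange K).toAffine.Point, (2 : ℤ) • R' = R :=
  halvingBit_of_steerAt W hr0 hρ hneg K hIQ hodd hHe ℓ₀ hdK h2K Wd hWd hSel hGZK fun y hyS hy0 hyd _ ↦ by
    obtain ⟨h, hh, hne⟩ := hdis y hyS hy0
    exact hne (hyd h hh)

/-- ★★ **On the phantom cell, `hHalf ⟺ ¬ 4 ∣ a_{ℓ₀}(E)`** — the (α)/(β) bit exactly.  Frame of `halvingBit_iff_forall_selmer_dying_not_four_dvd` plus a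
non-zero class `x ∈ Sel₂(W)` dying on `Γ_{ℚ(W[4])}` (the Lawson–Wuthrich class IS Selmer: the 2-adic bit FALSE).  So the LEAD road's residual bit holds at
the (α)-frames (`a_{ℓ₀}(E) ≡ 2 (mod 4)`) and FAILS at the (β)-frames (`4 ∣ a_{ℓ₀}(E)`) of such a curve — LEAD-BRIEF-g29 §3 in the kernel.  CONDITIONAL
only on GZK; BSD is NOT proved; K4Neg is NOT proved. [cite: LawsonWuthrich2016, §3, §7.1] [cite: GrossLMS1991, §9 Prop. 9.6] [cite: SilvermanAEC2009, Thm. V.2.3.1] -/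
theorem halvingBit_iff_not_four_dvd_of_selmer_phantom
    (W : WeierstrassCurve ℚ) [W.IsElliptic] [W.IsGloballyMinimal]
    (hr0 : W.analyticRank = 0) (hρ : ∀ n : ℕ, 0 < n → W.HasSurjectiveModNGaloisRep ((2 : ℤ) ^ n)) (hneg : W.Δ < 0)
    (K : Type) [Field K] [NumberField K] (hIQ : IsImaginaryQuadratic K) (hodd : Odd (discr K))
    (hHe : SatisfiesHeegnerHypothesis (W.conductorNorm ℤ) K)
    (ℓ₀ : ℕ) [Fact ℓ₀.Prime] (hdK : discr K = -(ℓ₀ : ℤ)) (h2K : ((Ideal.span {(2 : ℤ)}).primesOver (𝓞 K)).ncard = 2)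
    (Wd : WeierstrassCurve ℚ) [Wd.IsElliptic] (hWd : ∃ C : VariableChange ℚ, C • W.quadraticTwist (discr K : ℚ) = Wd)
    (hrd : Wd.analyticRank = 1) (hSel : Nat.card (Wd.selmerGroup 2) = 2) (hGZK : MultPublishedInputsAtTwo)
    {x : galH1Torsion W (2 : ℤ)} (hxS : x ∈ W.selmerGroup 2) (hx0 : x ≠ 0) (hx : ∀ h ∈ torsionFixing W (4 : ℤ), h1Eval W (2 : ℤ) x h = 0) :
    (∀ (R : (W.baseChange K).toAffine.Point) (Q : geomPoints (W.baseChange K)),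
      (∀ ρ ∈ torsionFixing (W.baseChange K) (4 : ℤ), ρ • Q = Q) → (2 : ℤ) • Q = toGeomPoints (W.baseChange K) R →
      ∃ R' : (W.baseChange K).toAffine.Point, (2 : ℤ) • R' = R) ↔
    ¬ (4 : ℤ) ∣ W.frobeniusTrace ℓ₀ := by
  rw [halvingBit_iff_forall_selmer_dying_not_four_dvd W hr0 hρ hneg K hIQ hodd hHe ℓ₀ hdK h2K Wd hWd hrd hSel hGZK]
  exact ⟨fun h ↦ h x hxS hx0 hx, fun h _ _ _ _ ↦ h⟩

end Summit.BirchSwinnertonDyer.BirchSwinnertonDyer.Theorems.GenusExact.PlusDescent.TwinHalves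

end
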